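import Literature.Analysis.FluidPDE.GKPCriticalElements
import Literature.Analysis.FluidPDE.NSLerayHopfSereginMild
import HarnessLib

/-!
# Albritton's blow-up criterion (`albritton_besov_blowup`): Corollary 4.6 and Step 0

Analysis/FluidPDE file next to the named fact
`Literature.Analysis.FluidPDE.albritton_besov_blowup` (`CriticalRegularity.lean`: Albritton,
*Blow-up criteria for the Navier–Stokes equations in non-endpoint critical Besov spaces*,
Anal. PDE 11 (2018) 1415–1456 = arXiv:1612.04439, **Thm. 1.1**: for `3 < p, q < ∞` and the mild
solution `NS(u₀)` of a divergence-free `u₀ ∈ Ḃ^{s_p}_{p,q}(ℝ³)` with finite maximal time of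
existence `T*`, `lim_{t ↑ T*} ‖u(t)‖_{Ḃ^{s_p}_{p,q}} = ∞`, `s_p = -1 + 3/p`).

## The printed proof (§3 of arXiv:1612.04439) and what this file vendors

Albritton's proof of Thm. 1.1 (§3, "Proof of Theorem 1.1", pp. 15–16) runs:

0. *Reduction to the diagonal class.* By the embedding `Ḃ^{s_p}_{p,q} ↪ Ḃ^{s_m}_{m,m}`,
   `m = max(p, q)` ("chain of embeddings") and the uniqueness part of Thm. 4.2, "without
   loss of generality, we will assume `p = q = m`".
1. *Rescaling.* "In Corollary 4.6, we proved that `u` must form a singularity at time `T*(u₀)`"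
   (Prop. 4.5 / **Cor. 4.6**, formation of a singularity at the blow-up time); by translation and
   scaling the singularity sits at the origin at time `T* = 1`. "Suppose for contradiction that
   there exists a sequence `t_n ↑ 1` and constant `M > 0` such that `‖u(t_n)‖_{Ḃ^{s_p}_{p,p}} ≤ M`"
   ((3.2)); `‖u(·, 1)‖ ≤ M` by `𝒮'`-continuity up to the final time; zoom in:
   `u⁽ⁿ⁾(x,t) = λ_n u(λ_n x, t_n + λ_n² t)`, `λ_n = (1 - t_n)^{1/2}`.
2. *Limiting procedure* (Thm. 2.7, weak convergence of Calderón solutions; Prop. 4.9,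
   persistence of singularities): a limit solution `v` on `Q₁`, singular at `(0, 1)`, with
   `v(·, 1) = 0`.
3. *Backward uniqueness* (Thm. 4.8 `ε`-regularity, Thm. 4.10 backward uniqueness, Thm. 4.11
   unique continuation, and the dense open set of smooth times): `v ≡ 0` on `Q_{1/2,1}`, "This
   contradicts that `v` is singular at time `T = 1` and finishes the proof."

This file vendors, over the vocabulary of `CriticalRegularity.lean` (Besov mild solutions
`IsBesovMildSolutionOn`, maximal ones `IsMaximalBesovMildSolution`, distributions `U t` of the
slices, `eHomBesovNorm`) and of `SuitableWeak.lean` (backward parabolic cylinders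
`parabolicCylinder r (T, x₀) = (T - r², T) × B(x₀, r)`, CKN 1982 §2; Albritton §4.4: "`z₀` is a
singular point of `u` if for all `0 < r < R`, `u ∉ L^∞(Q(z₀, r))`"):

* the named fact `albritton_singular_point_of_blowup` — **Cor. 4.6** (with Prop. 4.5), the one
  numbered result of the paper that Step 1 quotes: a maximal Besov mild solution with finite
  lifespan `T` has a singular point `(T, x₀)`, i.e. `u` is essentially unbounded on `Q_r(T, x₀)`
  for every `r ∈ (0, √T)` — **deprecated (mis-stated) since 2026-08-15**, see "What remains below
  this file": its faithful form, Cor. 4.6 over Albritton's class, is vendored and proved as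
  `albritton_singular_point_of_blowup_katoClass` (`AlbrittonSingularPointKatoClassHolds.lean`);
* **Step 0, proved**: `IsBesovMildSolutionOn.exists_diag_of_frequently_le` — a `liminf` bound in
  the class `(s_p, p, q)` passes to the diagonal class `(s_m, m, m)`, `m = max(p, q)`, along the
  critical embedding `‖·‖_{Ḃ^{s_m}_{m,m}} ≤ C ‖·‖_{Ḃ^{s_p}_{p,q}}` (BCD Prop. 2.20 = the named fact
  `Literature.Analysis.FunctionSpaces.besov_embedding`, a theorem of the tree, with
  `exists_eHomBesovNorm_critical_le` and `IsBesovMildSolutionOn.of_norm_le` of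
  `GKPCriticalElements.lean`);
* the transcription of hypothesis (3.2), proved: `frequently_nhdsLT_le_iff_seq` ("`‖U t‖ ≤ M`
  frequently as `t ↑ T`" *is* "`t_n ↑ T` with `‖u(t_n)‖ ≤ M`", first countability of `𝓝[<] T`)
  and `not_tendsto_nhds_top_iff_exists_frequently_le` ("`‖U t‖ ↛ ∞`" iff some finite level is
  undershot frequently — the opening "Suppose for contradiction …"), together with the reading of
  Thm. 1.1 at a maximal time, `albritton_besov_blowup.not_frequently_le`.

## The retired second half (review of the decomposition, 2026-08-15)

The first version of this file (the "first decomposition" of `albritton_besov_blowup`) also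
vendored a second named fact, `albritton_regular_of_liminf_besov` — "the core of the proof of
Thm. 1.1, §3 Steps 1–3": *a Besov mild solution on `[0, T)` of the diagonal class with
`liminf_{t ↑ T} ‖U t‖ < ∞` is essentially bounded on some `Q_r(T, x₀)` at every `x₀`* — and
proved Thm. 1.1 from Cor. 4.6 and it (`albritton_besov_blowup_of_singular_point`: Step 0, then
"every `(T, x₀)` is regular" against the singular point of Cor. 4.6 at the maximal time). On
review (D-0026) that fact was **retired and merged back into the proof obligation of
`albritton_besov_blowup`**: (i) it is not a distinct printed result but Steps 1–3 of the parent's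
own proof, whose discharge is the whole of §2 (Calderón solutions, Def. 2.1, Thms. 2.5–2.7),
§4.3 (Thm. 4.2) and §4.4 (Thm. 4.8, Prop. 4.9, Thms. 4.10–4.11); (ii) over the tree's class it is
a *corollary of the parent* — `albritton_besov_blowup.regular_of_frequently_le`
(`AlbrittonBlowupCriterionProofs.lean`: a finite `liminf` at `T` makes `T` non-maximal by
Thm. 1.1, the extension lies in Kato's class `K_∞` past `T`, so `u` is bounded on every
`Q_r(T, x₀)`, `r² < T`) — so the decomposition had cut Thm. 1.1 into Cor. 4.6 and a restatement
of itself. The assembly theorems that consumed it (`albritton_besov_blowup_of_singular_point`,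
`tendsto_eHomBesovNorm_top_of_isMaximal_diag`, and `albritton_besov_blowup_of_albritton`,
`gkp_besov_blowup_of_albritton_facts` of the proofs file) went with it; its other users were
rewired to the parent (`NSCriticalClosureBesovSingleLeaf.lean`, `NSCriticalClosureBesovAnalytic.lean`:
the "two halves" records dropped in favour of the `albritton_besov_blowup` ones;
`AlbrittonBlowupCriterionKatoHalves.lean`: the Kato-class form of the retired statement is now
`albritton_besov_blowup.regular_of_frequently_le_katoClass`).

## What remains below this file

The discharge of `albritton_besov_blowup` itself — Steps 0–3 above, given Cor. 4.6: parabolic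
rescaling and translation covariance of the solution class (cf. `NSSereginMildRescaling.lean` for
Kato solutions) with the dyadic scaling of `eHomBesovNorm` (`eHomBesovNorm_distribDilate`,
`LittlewoodPaley.lean`), weak-`*` compactness of Besov-bounded sequences and lower semicontinuity
of the Besov norm, the existence and weak convergence of Calderón solutions (Def. 2.1, Thms. 2.5,
2.6, 2.7), persistence of singularities (Prop. 4.9), `ε`-regularity (Thm. 4.8; cf. the tree's
`CKNEpsilonRegularity.lean`), backward uniqueness and unique continuation (Thms. 4.10, 4.11; cf.
`ESSBackwardUniquenessC1.lean`) — and of `albritton_singular_point_of_blowup` (Prop. 4.5: the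
Calderón splitting in `L^p`, the energy class of the remainder up to `T*`, `ε`-regularity outside
a large ball, and propagation of `L^∞ ∩ L^p` bounds, Lemma 4.4). **Class caveat**: both facts,
like `gkp_besov_blowup`, quantify over the tree's class `IsBesovMildSolutionOn` /
`IsMaximalBesovMildSolution` (duality-form mild solution, `C_t Ḃ^{s_p}_{p,q}`, Kato's `K_∞` only),
which is larger than Albritton's uniqueness classes (4.51)/(4.52); the printed theorems are about
`NS(u₀)` in the latter. For this reason the parent `albritton_besov_blowup` is **deprecated
(mis-stated)** since 2026-08-15 (`CriticalRegularity.lean`, §Verdict clean-up; faithful form wanted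
as `albritton_besov_blowup_pathSpace`), and the same analysis for Cor. 4.6 is recorded in
`AlbrittonBlowupCriterionKatoHalves.lean` (`albritton_singular_point_of_blowup_iff_katoClass`:
the vendored child = Cor. 4.6 over `IsMaximalKatoBesovMildSolution` + the unprinted identification
of the classes). **Disposition of the child (2026-08-15, verdict of its prove seat):**
`albritton_singular_point_of_blowup` is **deprecated (mis-stated)** as well and kept verbatim
(statement unchanged; `AlbrittonBlowupCriterionKatoHalves.lean` and
`AlbrittonSingularPointReduction.lean` take it as a hypothesis or a conclusion); its faithful form —
Cor. 4.6 over Albritton's class `IsMaximalKatoBesovMildSolution`, same cite — is vendored under the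
new name `albritton_singular_point_of_blowup_katoClass` **and proved**
(`albritton_singular_point_of_blowup_katoClass_holds`, `AlbrittonSingularPointKatoClassHolds.lean`)
by Albritton's own proof of Prop. 4.5 formalised over that class: the `L^∞` continuation inside
the class (`AlbrittonKatoClassIntegralForm.lean`), the Calderón splitting in `L^p`
(`CalderonSplittingLp.lean`), the long-lived bounded Oseen solution and the energy class of the
remainder up to `T*` (`LongLivedOseenSolution.lean`, `PerturbedEnergyInequality.lean`,
`RemainderEnergyClass.lean`, `AlbrittonRemainderSetup.lean`), and `ε`-regularity outside a large
ball (`AlbrittonFarFieldCalderon.lean`: the restarted member is a local Leray solution on the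
full slab, far-field bound, `katoClass_singular_point`).

## Transcription notes

* "`u` is the mild solution with initial data `u₀` and maximal time of existence `T*(u₀) < ∞`"
  = `(u, U)` is a maximal Besov mild solution with lifespan `0 < T < ∞`
  (`IsMaximalBesovMildSolution`, the standing identification of `CriticalRegularity.lean`,
  §Design choices "GKP's maximal time", shared with `gkp_besov_blowup` and
  `GKPCriticalElements.lean`; see the class caveat above); data are function-valued (`u 0`, seen
  through `U 0`), a specialisation of the printed distributional data.
* "`u` has a singular point at time `T*`" (§4.4: `u ∉ L^∞(Q(z₀, r))` for all small `r`) =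
  essential unboundedness of `uncurry u` on `parabolicCylinder r (T, x₀)` for all `0 < r`,
  `r² < T` (the cylinders inside the strip `(0, T) × ℝ³`; "all small `r`" and "all `r < √T`" are
  equivalent by monotonicity of the cylinders, `eLpNorm_top_parabolicCylinder_eq_top_of_small` of
  `NSLerayHopfSereginMild.lean`), the convention of `lemarieRieusset_singular_point_of_blowup`.
* "`liminf`" / (3.2) = `∃ M, ∃ᶠ t in 𝓝[<] T, ‖U t‖ ≤ M` (`frequently_nhdsLT_le_iff_seq`).
* Viscosity: Albritton takes `ν = 1`; as for `gkp_besov_blowup` the fact is stated for `ν > 0`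
  (apply the printed statement to `w(s, y) = ν⁻¹ u(s/ν, y)`; cylinders scale by `√ν` in time,
  boundedness is unaffected).

## References

* D. Albritton, *Blow-up criteria for the Navier–Stokes equations in non-endpoint critical Besov
  spaces*, Anal. PDE 11 (2018) 1415–1456 = arXiv:1612.04439 (numbering of the arXiv version):
  Thm. 1.1; §3 (proof of Thm. 1.1, pp. 15–16, Steps 1–3, hypothesis (3.2)); Def. 2.1,
  Thms. 2.5–2.7; Thm. 4.2, Lemma 4.4, Prop. 4.5, Cor. 4.6; §4.4 (singular points), Thm. 4.8,
  Prop. 4.9, Thms. 4.10–4.11.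
* G. Seregin, Comm. Math. Phys. 312 (2012) 833–845 (the rescaling scheme).
* H. Bahouri, J.-Y. Chemin, R. Danchin, *Fourier Analysis and Nonlinear PDE* (2011), Prop. 2.20.
* L. Caffarelli, R. Kohn, L. Nirenberg, Comm. Pure Appl. Math. 35 (1982), §2 (cylinders).
-/

noncomputable section

open MeasureTheory TemperedDistribution Set Function Filter Metric
open _root_.Topology
open scoped SchwartzMap ENNReal NNReal

namespace Literature.Analysis.FluidPDE

/-- Local notation for physical space `ℝ³ = EuclideanSpace ℝ (Fin 3)`. -/
local notation "ℝ³" => EuclideanSpace ℝ (Fin 3)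

/-- Local notation for the complexified target `ℂ³ = EuclideanSpace ℂ (Fin 3)`. -/
local notation "ℂ³" => EuclideanSpace ℂ (Fin 3)

/-! ### The sequential hypothesis (3.2) -/

/-- **Albritton's hypothesis (3.2) is a `liminf` hypothesis.** For `f : ℝ → [0, ∞]`, a level
`M` and a time `T`: `f t ≤ M` frequently as `t ↑ T` iff there is a sequence `t_n < T`,
`t_n → T`, with `f (t_n) ≤ M` for all `n` (Albritton 2018, §3, (3.2): "there exists a sequence
`t_n ↑ 1` and constant `M > 0` such that `‖u(·, t_n)‖ ≤ M`"; first countability of `𝓝[<] T`,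
Mathlib's `Filter.frequently_iff_seq_forall`, after discarding the finitely many terms `≥ T`).
[folklore] -/
theorem frequently_nhdsLT_le_iff_seq {f : ℝ → ℝ≥0∞} {T : ℝ} {M : ℝ≥0∞} :
    (∃ᶠ t in 𝓝[<] T, f t ≤ M) ↔
      ∃ t : ℕ → ℝ, (∀ n, t n < T) ∧ Tendsto t atTop (𝓝 T) ∧ ∀ n, f (t n) ≤ M := by
  rw [frequently_iff_seq_forall]
  constructor
  · rintro ⟨t, ht, hf⟩
    obtain ⟨ht₁, ht₂⟩ := tendsto_nhdsWithin_iff.1 ht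
    obtain ⟨N, hN⟩ := eventually_atTop.1 ht₂
    exact ⟨fun n => t (n + N), fun n => hN _ (Nat.le_add_left N n),
      ht₁.comp (tendsto_add_atTop_nat N), fun n => hf _⟩
  · rintro ⟨t, htT, ht, hf⟩
    exact ⟨t, tendsto_nhdsWithin_iff.2 ⟨ht, Eventually.of_forall htT⟩, hf⟩

/-- In `[0, ∞]`, `f ↛ ∞` along a filter iff some finite level `M : ℝ≥0` is undershot
frequently, `∃ M, ∃ᶠ t, f t ≤ M` (i.e. `liminf f < ∞`; negation of
`ENNReal.tendsto_nhds_top_iff_nnreal`). This is the opening move "Suppose for contradiction …" of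
Albritton 2018, §3. [folklore] -/
theorem not_tendsto_nhds_top_iff_exists_frequently_le {α : Type*} {l : Filter α} {f : α → ℝ≥0∞} :
    ¬ Tendsto f l (𝓝 ∞) ↔ ∃ M : ℝ≥0, ∃ᶠ t in l, f t ≤ M := by
  rw [ENNReal.tendsto_nhds_top_iff_nnreal, not_forall]
  refine exists_congr fun M => ?_
  rw [not_eventually]
  exact frequently_congr (Eventually.of_forall fun t => not_lt)

/-! ### The named fact: Corollary 4.6 -/

/-- **Deprecated (2026-08-15) — mis-stated** (verdict of its prove seat, verified against
arXiv:1612.04439, p. 23 (Prop. 4.5, Cor. 4.6) and pp. 20–21 (Thm. 4.2 and its class (4.52)); the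
statement is kept verbatim, unchanged, because `albritton_singular_point_of_blowup_of_katoClass`,
`katoClass_singular_point_of_albritton_singular_point_of_blowup`,
`albritton_singular_point_of_blowup_iff_katoClass`,
`albritton_singular_point_of_blowup.exists_singular_of_tendsto_eLpNorm_top`
(`AlbrittonBlowupCriterionKatoHalves.lean`) and `albritton_singular_point_of_blowup_of_continuation`,
`continuation_of_bounded_of_albritton_singular_point` (`AlbrittonSingularPointReduction.lean`)
take it as a hypothesis or a conclusion). *Intended:* Albritton 2018, **Cor. 4.6** ("Let `u` be
the mild solution of Theorem 4.2 with initial data `u₀`. If `T*(u₀) < ∞`, then `u` has a singular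
point at time `T*(u₀)`", from Prop. 4.5 — formation of a singularity at the blow-up time for
`L^p` data, `3 < p < ∞` — and `u(t₀) ∈ L^p ∩ L^∞` for `t₀ > 0` (Thm. 4.2, (4.2)); singular points
as in §4.4: "`z₀` is a singular point of `u` if for all `0 < r < R`, `u ∉ L^∞(Q(z₀, r))`",
`Q(z₀, R) = B(x₀, R) × (t₀ - R², t₀)`; used in §3, Step 1). *What is wrong:* in print the
corollary concerns the mild solution of Thm. 4.2 — the member of the uniqueness class (4.52),
`C([0,T); Ḃ^{s_p}_{p,q}) ∩ K̊_p ∩ K̊_∞` with the integral equation — and its maximal time of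
existence; this `Prop` quantifies instead over every `IsMaximalBesovMildSolution (-1+3/p) p q T ν
u U` (duality-form mild, `C_t Ḃ^{s_p}_{p,q} ∩ K_∞` only, no extension in that class), which is
neither Albritton's class nor a published uniqueness class (`CriticalRegularity.lean`, §Verdict
clean-up). Since the solution of Thm. 4.2 with `T* < ∞` *is* maximal in the tree's sense
(Thm. 4.2 (i) with `p₀ = ∞`; `albritton_singular_point_of_blowup.exists_singular_of_tendsto_eLpNorm_top`),
this `Prop` implies the printed corollary and asserts it, in addition, for every unidentified
member of the larger class: it is stated stronger than its source and follows from it only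
together with the unprinted identification of the two maximal notions — machine-checked:
`albritton_singular_point_of_blowup_iff_katoClass` (`AlbrittonBlowupCriterionKatoHalves.lean`).
*The faithful statement, vendored and proved:* Cor. 4.6 over Albritton's class
`IsMaximalKatoBesovMildSolution` (`AlbrittonBlowupCriterionKato.lean`), same cite, is the named
fact `Literature.Analysis.FluidPDE.albritton_singular_point_of_blowup_katoClass` with its proof
`albritton_singular_point_of_blowup_katoClass_holds` (`AlbrittonSingularPointKatoClassHolds.lean`;
Albritton's proof of Prop. 4.5 over that class, `AlbrittonFarFieldCalderon.katoClass_singular_point`).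
*Original content (unchanged):* let `ν > 0`, `3 < p, q < ∞`, `0 < T < ∞`, and `(u, U)` a
maximal Besov mild solution of the unforced Navier–Stokes equations on `ℝ³ × [0, T)` in the
class `C([0,T); Ḃ^{-1+3/p}_{p,q})` (`IsMaximalBesovMildSolution`; module docstring, transcription
notes). Then there is `x₀ ∈ ℝ³` such that `u` is essentially unbounded on the backward parabolic
cylinder `Q_r(T, x₀) = (T - r², T) × B(x₀, r)` for every `0 < r` with `r² < T`.
[cite: Albritton2018, Cor. 4.6 (with Prop. 4.5 and §4.4)] -/
@[deprecated "mis-stated (2026-08-15): Albritton 2018 Cor. 4.6 concerns the mild solution of his Thm. 4.2 (the member of the uniqueness class (4.52), C([0,T); Ḃ^{s_p}_{p,q}) ∩ K̊_p ∩ K̊_∞ with the integral equation) and its maximal time of existence, but this Prop quantifies over the tree's IsMaximalBesovMildSolution (duality-form mild, C_t Ḃ^{s_p}_{p,q} ∩ K_∞ only, no extension there — not a published uniqueness notion); it is the faithful statement + the unprinted identification of the two maximal notions (albritton_singular_point_of_blowup_iff_katoClass, AlbrittonBlowupCriterionKatoHalves.lean). Faithful form, vendored AND proved: Literature.Analysis.FluidPDE.albritton_singular_point_of_blowup_katoClass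 with albritton_singular_point_of_blowup_katoClass_holds (AlbrittonSingularPointKatoClassHolds.lean)" (since := "2026-08-15")]
def albritton_singular_point_of_blowup : Prop :=
  ∀ {ν : ℝ} (_hν : 0 < ν) {p q : ℝ≥0∞} [Fact (1 ≤ p)] (_hp₃ : 3 < p) (_hp : p < ∞)
    (_hq₃ : 3 < q) (_hq : q < ∞) {T : ℝ} (_hT : 0 < T) {u : ℝ → ℝ³ → ℝ³} {U : ℝ → 𝓢'(ℝ³, ℂ³)}
    (_hmax : IsMaximalBesovMildSolution (-1 + 3 / p.toReal) p q T ν u U),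
    ∃ x₀ : ℝ³, ∀ r : ℝ, 0 < r → r ^ 2 < T →
      eLpNorm (uncurry u) ∞ (volume.restrict (parabolicCylinder r ((T : ℝ), x₀))) = ∞

/-! ### Step 0: the passage to the diagonal class -/

/-- **Step 0 of Albritton's proof: the `liminf` bound passes to the diagonal class.** If
`‖U t‖_{Ḃ^{-1+3/p}_{p,q}} ≤ M` frequently as `t ↑ T` for a Besov mild solution of the class
`(s_p, p, q)`, `3 < p, q < ∞`, then, with `m = max(p, q)` and a constant `C` of the critical
embedding `Ḃ^{-1+3/p}_{p,q} ↪ Ḃ^{-1+3/m}_{m,m}` (BCD Prop. 2.20 as the hypothesis `hE`, through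
`exists_eHomBesovNorm_critical_le`), `(u, U)` is a Besov mild solution of the class `(s_m, m, m)`
with `‖U t‖_{Ḃ^{-1+3/m}_{m,m}} ≤ C M` frequently (Albritton 2018, §3, first paragraph of the
proof of Thm. 1.1: "without loss of generality, we will assume `p = q = m`").
[cite: Albritton2018, §3, proof of Thm. 1.1, first paragraph] -/
theorem IsBesovMildSolutionOn.exists_diag_of_frequently_le
    (hE : FunctionSpaces.besov_embedding (E := ℝ³) (F := ℂ³)) {ν : ℝ} {p q : ℝ≥0∞} [Fact (1 ≤ p)]
    (hp₃ : 3 < p) (hq₃ : 3 < q) {T : ℝ} {u : ℝ → ℝ³ → ℝ³}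
    {U : ℝ → 𝓢'(ℝ³, ℂ³)} (hu : IsBesovMildSolutionOn (-1 + 3 / p.toReal) p q T ν u U) {M : ℝ≥0}
    (hM : ∃ᶠ t in 𝓝[<] T, FunctionSpaces.eHomBesovNorm (-1 + 3 / p.toReal) p q (U t) ≤ M) :
    ∃ (_ : Fact (1 ≤ max p q)) (C : ℝ≥0),
      IsBesovMildSolutionOn (-1 + 3 / (max p q).toReal) (max p q) (max p q) T ν u U ∧
        ∃ᶠ t in 𝓝[<] T,
          FunctionSpaces.eHomBesovNorm (-1 + 3 / (max p q).toReal) (max p q) (max p q) (U t) ≤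
            (C * M : ℝ≥0) := by
  haveI hm1 : Fact (1 ≤ max p q) :=
    ⟨le_trans (le_trans (by norm_num) hp₃.le) (le_max_left p q)⟩
  have hq0 : q ≠ 0 := (lt_trans (by norm_num) hq₃).ne'
  obtain ⟨C, hC⟩ := exists_eHomBesovNorm_critical_le hE (le_max_left p q) hq0 (le_max_right p q)
  refine ⟨hm1, C, hu.of_norm_le hC, hM.mono fun t ht => (hC (U t)).trans ?_⟩
  rw [ENNReal.coe_mul]
  gcongr

/-! ### Theorem 1.1 at a maximal time -/

-- `linter.deprecated` is switched off for the next declaration only: its hypothesis is the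
-- deprecated (mis-stated, 2026-08-15) tree-class rendering `albritton_besov_blowup` of Thm. 1.1
-- (`CriticalRegularity.lean`), kept as such until the faithful `albritton_besov_blowup_pathSpace`
-- is vendored.
set_option linter.deprecated false in
/-- **Thm. 1.1 at a maximal time, `liminf` form**: if `albritton_besov_blowup` holds, a maximal
Besov mild solution with finite lifespan `T` has `liminf_{t ↑ T} ‖U t‖ = ∞`, i.e. no finite level
`M` is undershot frequently as `t ↑ T` — hypothesis (3.2) of §3 is never met at `T = T*`
(Albritton 2018, Thm. 1.1; used by `albritton_besov_blowup.exists_extension`,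
`AlbrittonBlowupCriterionContinuation.lean`). [cite: Albritton2018, Thm. 1.1] -/
theorem albritton_besov_blowup.not_frequently_le (h : albritton_besov_blowup) {ν : ℝ} (hν : 0 < ν)
    {p q : ℝ≥0∞} [Fact (1 ≤ p)] (hp₃ : 3 < p) (hp : p < ∞) (hq₃ : 3 < q) (hq : q < ∞) {T : ℝ}
    (hT : 0 < T) {u : ℝ → ℝ³ → ℝ³} {U : ℝ → 𝓢'(ℝ³, ℂ³)}
    (hmax : IsMaximalBesovMildSolution (-1 + 3 / p.toReal) p q T ν u U) (M : ℝ≥0) :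
    ¬ ∃ᶠ t in 𝓝[<] T, FunctionSpaces.eHomBesovNorm (-1 + 3 / p.toReal) p q (U t) ≤ M := by
  have ht := h hν hp₃ hp hq₃ hq hT hmax
  rw [ENNReal.tendsto_nhds_top_iff_nnreal] at ht
  rw [not_frequently]
  exact (ht M).mono fun t ht' => not_le.2 ht'

end Literature.Analysis.FluidPDE

end
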